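import Literature.LinearAlgebra.RationalForms.MonomialRigidity
import HarnessLib

/-!
# Rigidity of rational structures under monomial symmetries, II: the coordinate projections from
# separating sign symmetries

Family `linear-algebra`, layer `Literature/LinearAlgebra/RationalForms`. Companion to
`MonomialRigidity` (`exists_ratBasis_smul_basis`: a rational `ℚ`-subspace `S ⊆ V` of full size,
stable under the coordinate projections of a basis `b` and under linear maps permuting the `b_w` up
to sign, is `c · (⊕_w ℚ b_w)` for ONE scalar `c`). Its hypothesis `hproj` — the coordinate
projections `s ↦ b*_w(s) b_w` preserve `S` — is here DERIVED from the existence of enough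
`S`-preserving **sign symmetries**: linear maps acting diagonally on `b` with eigenvalues `±1`.
If for every pair `w ≠ w'` some such symmetry `P` has different signs on `b_w` and `b_{w'}`, then
`½(1 + ε_w P)` preserves `S` (it is a rational combination of `1` and `P`), fixes `b_w`, kills
`b_{w'}` and maps every other `b_v` to `b_v` or `0`; the composite over all `w' ≠ w` is exactly the
coordinate projection onto `ℂ b_w`, which therefore preserves `S`
(`coord_smul_mem_of_signOperators`). Feeding this into `exists_ratBasis_smul_basis` gives
`exists_ratBasis_smul_basis_of_signOperators`.

This is the shape in which the rigidity is used for the cohomology of a complex torus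
`X = ℂ^g/Λ`: the automorphisms `x_p ↦ -x_p` of the lattice act on the classes `dx_I` by the signs
`(-1)^{[p ∈ I]}`, which separate the `dx_I`, and the permutations of the lattice basis permute them
(Lange–Birkenhake 1992, §1.1.2–§1.1.4; used in
`Literature/Barriers/HodgeConjecture/GeneralizedHodgeTrivialReasonsEllipticCurveCubedRational`).
Elementary linear algebra, PROVED, Mathlib only. [folklore]

## Main statements

* `list_prod_apply_mem`, `list_prod_apply_eq_self`, `list_prod_apply_eq_zero` — bookkeeping for
  composites of endomorphisms acting on a vector by `1` or `0`;
* `coord_smul_mem_of_signOperators` — separating sign symmetries ⇒ the coordinate projections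
  preserve `S`;
* `exists_ratBasis_smul_basis_of_signOperators` — the rigidity theorem with `hproj` replaced by
  sign symmetries.
-/

noncomputable section

open Function Module

namespace Literature.LinearAlgebra.RationalForms

variable {V : Type*} [AddCommGroup V] [Module ℂ V]

/-! ### Composites of endomorphisms -/

section ListProd

/-- A composite of `S`-preserving endomorphisms preserves `S`. [folklore] -/
theorem list_prod_apply_mem {S : Set V} (L : List (Module.End ℂ V))
    (hL : ∀ P ∈ L, ∀ s ∈ S, P s ∈ S) {s : V} (hs : s ∈ S) : L.prod s ∈ S := by
  induction L with
  | nil => simpa using hs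
  | cons P L ih =>
    rw [List.prod_cons, Module.End.mul_apply]
    exact hL P List.mem_cons_self _ (ih fun Q hQ ↦ hL Q (List.mem_cons_of_mem _ hQ))

/-- A composite of endomorphisms fixing `x` fixes `x`. [folklore] -/
theorem list_prod_apply_eq_self (L : List (Module.End ℂ V)) {x : V} (h : ∀ P ∈ L, P x = x) :
    L.prod x = x := by
  induction L with
  | nil => simp
  | cons P L ih =>
    rw [List.prod_cons, Module.End.mul_apply, ih fun Q hQ ↦ h Q (List.mem_cons_of_mem _ hQ)]
    exact h P List.mem_cons_self

/-- A composite of endomorphisms each mapping `x` to `x` or to `0` maps `x` to `x` or to `0`. [folklore] -/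
theorem list_prod_apply_eq_self_or_zero (L : List (Module.End ℂ V)) {x : V}
    (h : ∀ P ∈ L, P x = x ∨ P x = 0) : L.prod x = x ∨ L.prod x = 0 := by
  induction L with
  | nil => simp
  | cons P L ih =>
    rw [List.prod_cons, Module.End.mul_apply]
    rcases ih fun Q hQ ↦ h Q (List.mem_cons_of_mem _ hQ) with hL | hL
    · rw [hL]; exact h P List.mem_cons_self
    · rw [hL, map_zero]; exact Or.inr rfl

/-- … and maps `x` to `0` as soon as one factor does. [folklore] -/
theorem list_prod_apply_eq_zero (L : List (Module.End ℂ V)) {x : V}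
    (h : ∀ P ∈ L, P x = x ∨ P x = 0) (h0 : ∃ P ∈ L, P x = 0) : L.prod x = 0 := by
  induction L with
  | nil => simp at h0
  | cons P L ih =>
    rw [List.prod_cons, Module.End.mul_apply]
    have hL : ∀ Q ∈ L, Q x = x ∨ Q x = 0 := fun Q hQ ↦ h Q (List.mem_cons_of_mem _ hQ)
    obtain ⟨Q, hQ, hQx⟩ := h0
    rcases List.mem_cons.1 hQ with rfl | hQL
    · rcases list_prod_apply_eq_self_or_zero L hL with h1 | h1
      · rw [h1, hQx]
      · rw [h1, map_zero]
    · rw [ih hL ⟨Q, hQL, hQx⟩, map_zero]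

end ListProd

/-! ### Coordinate projections from separating sign symmetries -/

section Signs

variable {n : ℕ} (b : Basis (Fin n) ℂ V) {S : Set V}

/-- **The normalised projector `½(1 + ε_w P)` of a sign symmetry.** If `P` preserves the rational
`ℚ`-subspace `S` and acts diagonally on the basis `b` with signs `ε_v = ±1`, then `R = ½(1 + ε_w P)`
preserves `S`, fixes `b_w`, and maps `b_v` to `b_v` if `ε_v = ε_w` and to `0` otherwise. [folklore] -/
theorem halfOnePlusSign_apply (hS : IsRatSubspace S) (P : V →ₗ[ℂ] V) (hP : ∀ s ∈ S, P s ∈ S)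
    (ε : Fin n → ℂ) (hε : ∀ v, ε v = 1 ∨ ε v = -1) (hPb : ∀ v, P (b v) = ε v • b v) (w : Fin n) :
    let R : Module.End ℂ V := (((1 / 2 : ℚ) : ℂ)) • (1 + ε w • P)
    (∀ s ∈ S, R s ∈ S) ∧ (∀ v, ε v = ε w → R (b v) = b v) ∧ (∀ v, ε v ≠ ε w → R (b v) = 0) := by
  intro R
  have hR : ∀ x, R x = ((1 / 2 : ℚ) : ℂ) • (x + ε w • P x) := fun x ↦ rfl
  refine ⟨fun s hs ↦ ?_, fun v hv ↦ ?_, fun v hv ↦ ?_⟩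
  · rw [hR]
    refine hS.smul_mem _ (hS.add_mem hs ?_)
    rcases hε w with h | h
    · rw [h, one_smul]; exact hP s hs
    · rw [h, neg_one_smul]; exact hS.neg_mem (hP s hs)
  · rw [hR, hPb, hv, smul_smul]
    rcases hε w with h | h
    · rw [h, one_mul, one_smul, ← two_smul ℂ, smul_smul]
      norm_num
    · rw [h, neg_one_mul, neg_neg, one_smul, ← two_smul ℂ, smul_smul]
      norm_num
  · rw [hR, hPb, smul_smul]
    rcases hε w with h | h <;> rcases hε v with h' | h'
    · exact absurd (h'.trans h.symm) hv
    · rw [h, h']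
      norm_num
    · rw [h, h']
      norm_num
    · exact absurd (h'.trans h.symm) hv

/-- **Separating sign symmetries make the coordinate projections `S`-preserving.** Let `b` be a
basis and `S` a rational `ℚ`-subspace such that for all `w ≠ w'` some `S`-preserving linear map
acts diagonally on `b` with signs `±1` that differ at `w` and `w'`. Then for every `w` and `s ∈ S`,
`b*_w(s) • b_w ∈ S` (hypothesis `hproj` of `exists_ratBasis_smul_basis`): the composite of the
normalised projectors `½(1 + ε_w P)` over all `w' ≠ w` is the coordinate projection onto `ℂ b_w`.
[folklore] -/
theorem coord_smul_mem_of_signOperators (hS : IsRatSubspace S)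
    (hsign : ∀ w w' : Fin n, w ≠ w' → ∃ P : V →ₗ[ℂ] V, (∀ s ∈ S, P s ∈ S) ∧
      ∃ ε : Fin n → ℂ, (∀ v, ε v = 1 ∨ ε v = -1) ∧ (∀ v, P (b v) = ε v • b v) ∧ ε w ≠ ε w')
    (w : Fin n) : ∀ s ∈ S, b.coord w s • b w ∈ S := by
  classical
  choose P hPS ε hε hPb hne using hsign w
  -- the normalised projectors, `1` at `w' = w`
  let R : Fin n → Module.End ℂ V := fun w' ↦
    if h : w ≠ w' then (((1 / 2 : ℚ) : ℂ)) • (1 + ε w' h w • P w' h) else 1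
  have hRS : ∀ w', ∀ s ∈ S, R w' s ∈ S := fun w' s hs ↦ by
    by_cases h : w ≠ w'
    · simp only [R, dif_pos h]
      exact (halfOnePlusSign_apply b hS (P w' h) (hPS w' h) (ε w' h) (hε w' h) (hPb w' h) w).1 s hs
    · simp only [R, dif_neg h]; exact hs
  have hRw : ∀ w', R w' (b w) = b w := fun w' ↦ by
    by_cases h : w ≠ w'
    · simp only [R, dif_pos h]
      exact (halfOnePlusSign_apply b hS (P w' h) (hPS w' h) (ε w' h) (hε w' h) (hPb w' h) w).2.1
        w rfl
    · simp only [R, dif_neg h]; rfl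
  have hRv : ∀ w' v, R w' (b v) = b v ∨ R w' (b v) = 0 := fun w' v ↦ by
    by_cases h : w ≠ w'
    · simp only [R, dif_pos h]
      have H := halfOnePlusSign_apply b hS (P w' h) (hPS w' h) (ε w' h) (hε w' h) (hPb w' h) w
      by_cases hv : ε w' h v = ε w' h w
      · exact Or.inl (H.2.1 v hv)
      · exact Or.inr (H.2.2 v hv)
    · simp only [R, dif_neg h]; exact Or.inl rfl
  have hRkill : ∀ v, w ≠ v → R v (b v) = 0 := fun v h ↦ by
    simp only [R, dif_pos h]
    exact (halfOnePlusSign_apply b hS (P v h) (hPS v h) (ε v h) (hε v h) (hPb v h) w).2.2 v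
      (fun h' ↦ hne v h h'.symm)
  -- the composite is the coordinate projection
  let Q : Module.End ℂ V := ((List.finRange n).map R).prod
  have hQ : Q = (b.coord w).smulRight (b w) := by
    refine b.ext fun v ↦ ?_
    rw [LinearMap.smulRight_apply, Basis.coord_apply, Basis.repr_self, Finsupp.single_apply]
    by_cases hv : v = w
    · subst hv
      rw [if_pos rfl, one_smul]
      exact list_prod_apply_eq_self _ fun P hP ↦ by
        obtain ⟨w', -, rfl⟩ := List.mem_map.1 hP
        exact hRw w'
    · rw [if_neg hv, zero_smul]
      exact list_prod_apply_eq_zero _ (fun P hP ↦ by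
        obtain ⟨w', -, rfl⟩ := List.mem_map.1 hP
        exact hRv w' v) ⟨R v, List.mem_map.2 ⟨v, List.mem_finRange v, rfl⟩, hRkill v (Ne.symm hv)⟩
  intro s hs
  have h := list_prod_apply_mem (S := S) ((List.finRange n).map R) (fun P hP ↦ by
    obtain ⟨w', -, rfl⟩ := List.mem_map.1 hP
    exact hRS w') hs
  change Q s ∈ S at h
  rwa [hQ, LinearMap.smulRight_apply] at h

/-- **Rigidity of rational structures under monomial symmetries (sign-symmetry form).** Let `b` be
a basis of `V` and `S ⊆ V` a rational `ℚ`-subspace containing a `ℚ`-independent family of full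
size, such that (i) for all `w ≠ w'` some `S`-preserving linear map acts diagonally on `b` with
signs `±1` differing at `w, w'`, and (ii) for all `w, w'` some `S`-preserving linear map sends
`b_w` to `± b_{w'}`. Then for ONE scalar `c ≠ 0` the vectors `c • b_w` lie in `S` and every element
of `S` is a rational combination of them with unique coefficients. [folklore] -/
theorem exists_ratBasis_smul_basis_of_signOperators (hS : IsRatSubspace S) (hR : IsRational S)
    (hfull : ∃ f : Fin n → V, (∀ i, f i ∈ S) ∧
      ∀ q : Fin n → ℚ, ∑ i, ((q i : ℚ) : ℂ) • f i = 0 → q = 0)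
    (hsign : ∀ w w' : Fin n, w ≠ w' → ∃ P : V →ₗ[ℂ] V, (∀ s ∈ S, P s ∈ S) ∧
      ∃ ε : Fin n → ℂ, (∀ v, ε v = 1 ∨ ε v = -1) ∧ (∀ v, P (b v) = ε v • b v) ∧ ε w ≠ ε w')
    (hperm : ∀ w w' : Fin n, ∃ P : V →ₗ[ℂ] V, (∀ s ∈ S, P s ∈ S) ∧
      ∃ ε : ℂ, (ε = 1 ∨ ε = -1) ∧ P (b w) = ε • b w') :
    ∃ c : ℂ, c ≠ 0 ∧ (∀ w, c • b w ∈ S) ∧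
      ∀ s ∈ S, ∃! q : Fin n → ℚ, ∑ w, ((q w : ℚ) : ℂ) • (c • b w) = s :=
  exists_ratBasis_smul_basis b hS hR (coord_smul_mem_of_signOperators b hS hsign) hfull hperm

end Signs

end Literature.LinearAlgebra.RationalForms

end
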